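import Summits.Ventures.AbcSig.Rows.Bridge
import Summits.Ventures.AbcSig.Rows.C2aL317A6S
import Summits.Ventures.AbcSig.Rows.C2aL317A6SAB

/-!
# Venture AbcSig — CELL `C2aL317A6`: the census statement `Rows.C2aCellRed 317 (fun a => 6 ≤ a) ∅` from the two row theorems

S-VARIANT (p-lean g6 `gen6/spatch.py`) of `xcell_C2aL317A6`: kernel sieve discharges replace the cited pair(s) 317.1 @ 41 (see the row file(s) `Rows/C2aL317A6S.lean`, `Rows/C2aL317A6SAB.lean`).
HONEST FRAMING. COMPUTATION cell `pub-abcsig`; CONDITIONAL theorem; no claim on ABC or any summit. Hypotheses exactly as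
in `Rows/C2aL317A6X.lean` and `Rows/C2aL317A6XAB.lean`: `BS04Package` (CITED), `DataComplete …` (COMPUTED level files), `EisPackage` (CITED) and `Refines` (COMPUTED) for the M6 orbits discharged in the kernel, and the
rows' per-orbit exclusions for BOTH family predicates (`famB`, `famAB`) as universally quantified hypotheses (CITED: the census
row's certificates). Conclusion = p1's census predicate (`Rows/Statements.lean`), all four coprime coefficient
distributions `A·B = 2^a·317^m`, reduced exponents `a < n`, `m < n` (RULING H1). GENERATED by p-lean g2 gen/make_rows.py
(after plean/make_cell_bridges.py).
-/

namespace Summit.Ventures.AbcSig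

/-- Cell `C2aL317A6` (M6 orbits discharged in the kernel): `Rows.C2aCellRed 317 (fun a => 6 ≤ a) ∅` under the rows' hypotheses. -/
theorem xcell_C2aL317A6S (M : NewformModel) (hP : M.BS04Package)
    (hE : M.EisPackage)
    (hD317 : M.DataComplete 317 level317Orbits)
    (hD634 : M.DataComplete 634 level634Orbits)
    (hR_orbit_317_2 : M.Refines 317 orbit_317_2 m6X_317_2)
    (hR_orbit_634_4 : M.Refines 634 orbit_634_4 m6X_634_4)
    (hRB_orbit_317_1 : ∀ f : M.Form 317, M.Matches f orbit_317_1 → M.Matches f rb_317_1) :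
    Rows.C2aCellRed 317 (fun a => 6 ≤ a) ∅ :=
  C2aCellRed_of_rows 317 (by norm_num) (by norm_num) _ _
    (fun n hn h11 hnℓ _ a m ha han hm hmn x y z h1 h2 =>
      xrow_C2aL317A6S M hP hE hD317 hD634 hR_orbit_317_2 hR_orbit_634_4 n hn h11 hnℓ a m ha hm han hmn hRB_orbit_317_1 x y z h1 h2)
    (fun n hn h11 hnℓ _ a m ha han hm hmn x y z h1 h2 =>
      xrow_C2aL317A6SAB M hP hE hD317 hD634 hR_orbit_317_2 hR_orbit_634_4 n hn h11 hnℓ a m ha hm han hmn hRB_orbit_317_1 x y z h1 h2)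

end Summit.Ventures.AbcSig
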